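import Literature.IUT.HodgeArakelov.CohomologyLimitComapAct
import Literature.IUT.HodgeArakelov.CohomologyLimitKummerEvaluation
import Literature.IUT.HodgeArakelov.BadPrimeGaussianMonoidsGenuineRecordRestrictionIsoPair
import Literature.IUT.HodgeArakelov.ThetaEvaluationModelEvProofs

/-!
# [IUTchII] Cor 3.5 (ii) «`Ψ^ι_env(M^Θ_*) ⥲ Ψ_ξ(M^Θ_*)`» at the genuine `θ_env` data over `ℚ̄_pˣ` with the labelled copies
# identified through EQUALITY OF COEFFICIENT ACTIONS (repair of GAP-LEDGER G-w4d004-1, part 2: the (R)/(E1) junctions and the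
# restriction-isomorphism capstone restated over `h1LimComapAct`; proof-only)

S. Mochizuki, *Inter-universal Teichmüller theory II*, kurims Dec-2020 manuscript, Cor 3.5 (i)/(ii) pp. 94–95 («the inclusions
`G_v(M^Θ_*) ↪ Π_{v▶}(M^Θ_*▶)` determined by the various choices of the `D^δ_{t,μ_-}`»), Cor 2.8 (i) p. 82, Prop 3.1 (ii) p. 88
[cite: Mochizuki2012, Cor 3.5 (ii) p.95]. Claim key DISPUTED (D-0012). PROOF-ONLY companion (abc-iut cell, layer L6, seat
abc-iut-w4-d004 gen 4; node **IUTchII:Cor3.5(ii)**, restriction-ISO clause; finding F-w4d004-g4-1 / GAP-LEDGER G-w4d004-1).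
NO definition, NO `Prop` fact, NO instance.

WHAT CHANGES. In every family-level capstone of this node so far the restriction of label `t` was
`R_t = h1LimCongr (hφ t) ∘ (s_t)^*` with `hφ : ∀ t, phi ∘ s_t = φ₀` — an equality of HOMOMORPHISMS `G_v → (Π^tp_X)^Θ` that print's
configuration with ≥ 2 distinct labels cannot meet (finding F-w4d004-g4-1). HERE `R_t := h1LimComapAct … (s_t) … φ₀ (hφAct t)` —
the pull-back INTO the common `φ₀`-system under `hφAct : ∀ t g (a : l·Δ_Θ), conj(phi(s_t g)) a = conj(φ₀ g) a` (equality of ACTIONS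
on the cyclotome), which DOES hold at the genuine data for any family of sections of `ε` over a common map
(`hφAct_of_aug_eq`: `Ker ε` acts trivially on `l·Δ_Θ`, abc-iut-w4-d043's `aug_ker_acts_trivially`). Over this junction:
* §1 (generic limits) `comapAct_kummerContClass_map`, `h1LimComapAct_h1LimKummer_map` — naturality of abc-iut-w4-d007's limit
  Kummer map under an `ι`-equivariant EVALUATION `ev : A →* B` for the action-level pull-back (port of abc-iut-w4-d004 gen 3's
  `h1LimComap_h1LimKummer_map`, p433848);
* §2 (genuine record, ANY inversion family `iota`): `hφAct_of_aug_eq`; **`hRκ_toRecord_act`** ((R) «restriction of constants»: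
  `R_t (κ m) = κ₀ m`); **`hRθ_toRecord_of_evaluation_act`** ((E1): `R_t θ = κ₀ (q_t)` from the presentation `θ = κ_fun(fΘ)` and the
  VALUES `ev_t fΘ = q_t`); **`exists_unique_restrictionIso'_toRecord_padic_of_evaluation_act`** — the Cor 3.5 (ii) restriction
  isomorphism with (K), (R), (E1), `hU`, `hUsurj`, `hinj`, `hq₀` derived, the labelled copies identified print-faithfully.
Inputs otherwise as in `…RestrictionIsoOfEvaluation` (p434055): sections `s_t` (continuous into `Π^tp_{Ÿ̲̲}`), `G_v` acting on
`ℚ̄_pˣ` as through the sections (`hact`), one section with finite-index `ε`-image, model data `c`/`c₀` (bijective, same underlying map),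
`horb` (dischargeable: `horb_toRecord_pairRhoLim` etc.), the evaluation data (E2). HONEST FRAMING: composition of landed theorems over
the cell's own objects; nothing disputed is asserted; no side is taken on [IUTchIII] Cor 3.12; typed ≠ proved ≠ endorsed.
-/

noncomputable section

namespace Literature.IUT.HodgeArakelov

open Literature.AnabelianGeometry.EtaleTheta CohomologySystemOfContH1

/-! ### §1. Generic: the limit Kummer map under an equivariant evaluation, action-level pull-back -/

section FixedLevelMap

variable {G₀ G G' : Type*} [Group G₀] [TopologicalSpace G₀] [SeparatelyContinuousMul G₀]
  [Group G] [TopologicalSpace G] [SeparatelyContinuousMul G]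
  [Group G'] [TopologicalSpace G'] [IsTopologicalGroup G']
  {φ : G →* G'} {A' : Subgroup G'} [A'.Normal] [IsMulCommutative A']
  {A B : Type*} [CommGroup A] [CommGroup B] [MulDistribMulAction G A] [MulDistribMulAction G₀ B]
  [TopologicalSpace A] [TopologicalSpace B]

/-- Fixed level: the action-level pull-back of the Kummer class of `a` (root system `x`) along an `ι`-equivariant evaluation
`ev : A →* B` is the Kummer class of `ev a` (root system `x.map ev`), for coefficient data with `c₀ ∘ Λ(ev) = c`.
[cite: NeukirchSchmidtWingberg2008, I §5] -/
theorem comapAct_kummerContClass_map (ι : G₀ →* G) (hι : Continuous ι) (φ₀ : G₀ →* G')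
    (hact : ∀ (g : G₀) (a : A'), MulAut.conjNormal (φ (ι g)) a = MulAut.conjNormal (φ₀ g) a)
    (ev : A →* B) (hev : ∀ (g : G₀) (a : A), ev (ι g • a) = g • ev a)
    (c : CyclotomeCoefficients φ A' A) (c₀ : CyclotomeCoefficients φ₀ A' B)
    (hc : ∀ ζ : cyclotome A, c₀.hom (cyclotome.map ev ζ) = c.hom ζ) {H₀ : Subgroup G₀} {H : Subgroup G}
    (hle : H₀.map ι ≤ H) {a : A} (x : RootSystem a) (ha : a ∈ MulAction.fixedPoints H A)
    (hx : ∀ n : ℕ+, IsOpen (MulAction.stabilizer G (x.root n) : Set G))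
    (ha₀ : ev a ∈ MulAction.fixedPoints H₀ B)
    (hx₀ : ∀ n : ℕ+, IsOpen (MulAction.stabilizer G₀ ((x.map ev).root n) : Set G₀)) :
    contH1ComapAct φ A' ι hι φ₀ hact hle (c.kummerContClass H x ha hx) = c₀.kummerContClass H₀ (x.map ev) ha₀ hx₀ := by
  rw [CyclotomeCoefficients.kummerContClass, CyclotomeCoefficients.kummerContClass, contH1ComapAct_mk]
  refine ContH1.mk_congr _ (funext fun y => ?_) _ _
  rw [← hc]
  congr 1
  refine Subtype.ext (funext fun n => ?_)
  rw [cyclotome.map_apply, RootSystem.kummerCocycle_apply, RootSystem.kummerCocycle_apply, RootSystem.map_root,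
    Subgroup.smul_def, Subgroup.smul_def, map_div, hev]

end FixedLevelMap

section LimitMap

variable {P₀ P : TopGroup.{0}} {G' : Type} [Group G'] [TopologicalSpace G'] [IsTopologicalGroup G']
  (φ : P →* G') (A' : Subgroup G') [A'.Normal] [IsMulCommutative A'] (H : Subgroup P)
  {A B : Type} [CommGroup A] [CommGroup B] [MulDistribMulAction P A] [MulDistribMulAction P₀ B]
  [TopologicalSpace A] [TopologicalSpace B] [RootableBy A ℕ] [RootableBy B ℕ]
  (c : CyclotomeCoefficients φ A' A)
  (hA : ∀ b : A, IsOpen (MulAction.stabilizer P b : Set P))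
  (hfi : ∀ b : A, (MulAction.stabilizer P b).FiniteIndex)
  (ι : P₀ →* P) (hι : Continuous ι) (φ₀ : P₀ →* G')
  (hact : ∀ (g : P₀) (a : A'), MulAut.conjNormal (φ (ι g)) a = MulAut.conjNormal (φ₀ g) a) {H₀ : Subgroup P₀}

/-- **Naturality of the limit Kummer map under an equivariant evaluation, action-level pull-back**: `h1LimComapAct` carries
`κ_{Π,A}(a)` (coefficients `c` over `φ`) to `κ_{Π₀,B}(ev a)` (ANY coefficients `c₀` over `φ₀` with `c₀ ∘ Λ(ev) = c`).
[cite: NeukirchSchmidtWingberg2008, I §5] -/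
theorem h1LimComapAct_h1LimKummer_map (hH : H₀.map ι ≤ H) (ev : A →* B)
    (hev : ∀ (g : P₀) (a : A), ev (ι g • a) = g • ev a)
    (c₀ : CyclotomeCoefficients φ₀ A' B) (hc : ∀ ζ : cyclotome A, c₀.hom (cyclotome.map ev ζ) = c.hom ζ)
    (hB₀ : ∀ b : B, IsOpen (MulAction.stabilizer P₀ b : Set P₀))
    (hfi₀ : ∀ b : B, (MulAction.stabilizer P₀ b).FiniteIndex) (a : A) :
    h1LimComapAct φ A' ι hι φ₀ hact hH (Multiplicative.toAdd (h1LimKummer φ A' H c hA hfi a)) =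
      Multiplicative.toAdd (h1LimKummer φ₀ A' H₀ c₀ hB₀ hfi₀ (ev a)) := by
  have ha := mem_fixedPoints_stabIdx H hA hfi a
  have ha₀ := mem_fixedPoints_inf_comap_map H ι hι hH ev hev (stabIdx hA hfi a) ha
  rw [h1LimKummer_eq_h1Of_kummerContClass φ A' H c hA hfi a (stabIdx hA hfi a) ha (RootSystem.ofRootableBy a),
    h1LimKummer_eq_h1Of_kummerContClass φ₀ A' H₀ c₀ hB₀ hfi₀ (ev a) (Idx.comap ι hι (stabIdx hA hfi a)) ha₀
      ((RootSystem.ofRootableBy a).map ev),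
    toAdd_ofAdd, toAdd_ofAdd, h1LimComapAct_of]
  refine congrArg (h1Of φ₀ A' H₀ ⊥ (Idx.comap ι hι (stabIdx hA hfi a))) ?_
  change Additive.ofMul (contH1ComapAct φ A' ι hι φ₀ hact (inf_comap_map_le ι hι hH (stabIdx hA hfi a))
      (c.kummerContClass (H ⊓ (stabIdx hA hfi a).K) (RootSystem.ofRootableBy a) ha fun _ => hA _)) = _
  rw [comapAct_kummerContClass_map ι hι φ₀ hact ev hev c c₀ hc (inf_comap_map_le ι hι hH (stabIdx hA hfi a))
    (RootSystem.ofRootableBy a) ha (fun _ => hA _) ha₀ (fun _ => hB₀ _)]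

end LimitMap

/-! ### §2. At the genuine `θ_env` data of `X̲̲_K`: (R), (E1) and the Cor 3.5 (ii) «⥲» over the action-level junction -/

namespace EtaleLevels

open EtaleThetaDataOfSetting TemperedThetaMonoids BadPrimeGaussianMonoids

variable {p : ℕ} [Fact p.Prime] {D : Literature.AnabelianGeometry.EtaleTheta.ThetaSetting p}
  {E : D.EtaleThetaData} {l : ℕ} (C : E.DoubleUnderline l) (hC : D.Compat) (hS : D.Sec2Hyps)
  (hl : l.Prime) (hp2 : p ≠ 2) (hpl : p ≠ l) (hζ : ∃ ζ : D.K, IsPrimitiveRoot ζ (4 * l))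
  (mods : ∀ M : ℕ+, D.CyclotomeMod l M)
  (f : contCocycles D.toTheta D.DeltaTheta C.GtpYdduu) (hf : f ∈ C.rootCocycles hC)
  (hmods : ∀ (M M' : ℕ+) (h : (M : ℕ) ∣ (M' : ℕ)) (x : D.lDeltaTheta l),
    MuN.red p M M' h ((mods M').red x) = (mods M).red x)
  (h15 : Literature.AnabelianGeometry.EtaleTheta.ThetaSetting.Prop15iii E hC) (L : C.CuspLabels)
  (hZ : ∀ M : ℕ+, Nonempty (ModelCyclotomes.lDeltaQuot (C.rigidData (mods M) hC hS h15 L) ≃*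
    Literature.IUT.HodgeTheaters.ZHat))
  (hcharY : EtaleThetaDataOfSetting.PiYddCharacteristic C)
  (hlim : Function.Bijective (rigidLimHom C hC hS hl hp2 hpl hζ mods f hf hmods h15 L hZ))
  [(EtaleThetaDataOfSetting.PiYdd C).Normal]
  {Iota : Type}
  (iota : Iota → ((thetaEnvData C hC hS hl hp2 hpl hζ mods f hf hmods h15 L hZ hcharY hlim).D.coh.lim ≃+
    (thetaEnvData C hC hS hl hp2 hpl hζ mods f hf hmods h15 L hZ hcharY hlim).D.coh.lim))
  {Lbl : Type*} {P₀ : TopGroup.{0}} (φ₀ : P₀ →* D.GtpTheta) (s : Lbl → (P₀ →* Pi C))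
  (hι : ∀ t, Continuous ((MonoidHom.id (Pi C)).comp (s t)))
  (hN : ∀ t, (⊤ : Subgroup P₀).map ((MonoidHom.id (Pi C)).comp (s t)) ≤ PiYdd C)
  -- THE ACTION-LEVEL JUNCTION (replaces `hφ : ∀ t, (phi C).comp (s t) = φ₀`)
  (hφAct : ∀ (t : Lbl) (g : P₀) (a : D.lDeltaTheta l),
    MulAut.conjNormal (phi C (((MonoidHom.id (Pi C)).comp (s t)) g)) a = MulAut.conjNormal (φ₀ g) a)

omit [(EtaleThetaDataOfSetting.PiYdd C).Normal] in
/-- **The action-level junction HOLDS at the genuine data for sections of `ε` over a common map**: if `ε ∘ s_t = ε ∘ s_{t₀}` for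
every label (e.g. all `s_t` are sections of `ε` over one `w : G_v → G_{ℚ_p}`), then conjugation through `phi ∘ s_t` and through
`phi ∘ s_{t₀}` agree on `l·Δ_Θ` — `Ker ε` acts trivially on the cyclotome (abc-iut-w4-d043's `aug_ker_acts_trivially`; `Δ_Θ` is
central in `Δ^Θ_X`, [EtTh] §1). So `φ₀ := phi ∘ s_{t₀}` serves every label. [cite: MochizukiEtTh2009, Prop 1.3 p.15] -/
theorem hφAct_of_aug_eq (t₀ : Lbl) (hsec : ∀ (t : Lbl) (g : P₀), aug C (s t g) = aug C (s t₀ g))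
    (t : Lbl) (g : P₀) (a : D.lDeltaTheta l) :
    MulAut.conjNormal (phi C (((MonoidHom.id (Pi C)).comp (s t)) g)) a =
      MulAut.conjNormal (((phi C).comp ((MonoidHom.id (Pi C)).comp (s t₀))) g) a := by
  have hker : aug C (s t g * (s t₀ g)⁻¹) = 1 := by
    rw [map_mul, map_inv, hsec t g, mul_inv_cancel]
  have h1 := aug_ker_acts_trivially C (s t g * (s t₀ g)⁻¹) hker (MulAut.conjNormal (phi C (s t₀ g)) a)
  have h2 : MulAut.conjNormal (phi C (s t g * (s t₀ g)⁻¹)) (MulAut.conjNormal (phi C (s t₀ g)) a) =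
      MulAut.conjNormal (phi C (s t g)) a := by
    rw [← MulAut.mul_apply, ← map_mul, ← map_mul, inv_mul_cancel_right]
  change MulAut.conjNormal (phi C (s t g)) a = MulAut.conjNormal (phi C (s t₀ g)) a
  rw [← h2, h1]

section AnyConstants

variable {A : Type} [CommGroup A] [MulDistribMulAction (Pi C) A] [TopologicalSpace A] [RootableBy A ℕ]
  (c : CyclotomeCoefficients (phi C) (D.lDeltaTheta l) A)
  (hA : ∀ b : A, IsOpen (MulAction.stabilizer (Pi C) b : Set (Pi C)))
  (hfi : ∀ b : A, (MulAction.stabilizer (Pi C) b).FiniteIndex)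
  (O : Submonoid A)
  [MulDistribMulAction P₀ A]
  (c₀ : CyclotomeCoefficients φ₀ (D.lDeltaTheta l) A)
  (hA₀ : ∀ b : A, IsOpen (MulAction.stabilizer P₀ b : Set P₀))
  (hfi₀ : ∀ b : A, (MulAction.stabilizer P₀ b).FiniteIndex)

/-- **(R) «restriction of constants» over the action-level junction** ([IUTchII] Cor 3.5 (i) p. 94): with
`R_t := h1LimComapAct … (s_t) … φ₀ (hφAct t)` (any `R_t` pinned to it by `hR`), the restriction of the Kummer class `κ m` of a
constant is the `G_v`-level Kummer class `κ₀ m` — `h1LimComapAct_h1LimKummerOn` (no `h1LimCongr`, no hom-equality).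
[cite: Mochizuki2012, Cor 3.5 (i) p.94] -/
theorem hRκ_toRecord_act (hc₀ : ∀ ζ, c₀.hom ζ = c.hom ζ)
    (hact : ∀ (t : Lbl) (g : P₀) (a : A), g • a = s t g • a)
    (R : Lbl → (((thetaEnvData C hC hS hl hp2 hpl hζ mods f hf hmods h15 L hZ hcharY hlim).toRecord
        (h1LimConjMulAut (phi C) (D.lDeltaTheta l) (PiYdd C))
        (h1LimKummerOn (phi C) (D.lDeltaTheta l) (PiYdd C) c hA hfi O) iota).H →*
      Multiplicative (h1Lim φ₀ (D.lDeltaTheta l) (⊤ : Subgroup P₀) ⊥)))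
    (hR : ∀ t y, Multiplicative.toAdd (R t y) =
      h1LimComapAct (phi C) (D.lDeltaTheta l) ((MonoidHom.id (Pi C)).comp (s t)) (hι t) φ₀ (hφAct t) (hN t)
        (AddEquiv.additiveMultiplicative (h1Lim (phi C) (D.lDeltaTheta l) (PiYdd C) ⊥) (Additive.ofMul y)))
    {i₀ : Iota} (t : Lbl) (m : O)
    (hm : h1LimKummerOn (phi C) (D.lDeltaTheta l) (PiYdd C) c hA hfi O m ∈
      ((thetaEnvData C hC hS hl hp2 hpl hζ mods f hf hmods h15 L hZ hcharY hlim).toRecord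
        (h1LimConjMulAut (phi C) (D.lDeltaTheta l) (PiYdd C))
        (h1LimKummerOn (phi C) (D.lDeltaTheta l) (PiYdd C) c hA hfi O) iota).thetaMonoid i₀) :
    ((R t).comp (((thetaEnvData C hC hS hl hp2 hpl hζ mods f hf hmods h15 L hZ hcharY hlim).toRecord
        (h1LimConjMulAut (phi C) (D.lDeltaTheta l) (PiYdd C))
        (h1LimKummerOn (phi C) (D.lDeltaTheta l) (PiYdd C) c hA hfi O) iota).thetaMonoid i₀).subtype)
        ⟨h1LimKummerOn (phi C) (D.lDeltaTheta l) (PiYdd C) c hA hfi O m, hm⟩ =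
      h1LimKummerOn φ₀ (D.lDeltaTheta l) ⊤ c₀ hA₀ hfi₀ O m := by
  apply Multiplicative.toAdd.injective
  rw [MonoidHom.comp_apply, Submonoid.subtype_apply, hR, additiveMultiplicative_h1LimKummerOn]
  exact h1LimComapAct_h1LimKummerOn (phi C) (D.lDeltaTheta l) (PiYdd C) c hA hfi ((MonoidHom.id (Pi C)).comp (s t))
    (hι t) φ₀ (hφAct t) (hN t) (fun g a => hact t g a) c₀ hc₀ hA₀ hfi₀ O m

end AnyConstants

section Padic

variable [TopologicalSpace (PadicAlgCl p)ˣ]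
  (c : CyclotomeCoefficients (phi C) (D.lDeltaTheta l) (PadicAlgCl p)ˣ)
  (hA : ∀ b : (PadicAlgCl p)ˣ, IsOpen (MulAction.stabilizer (Pi C) b : Set (Pi C)))
  (hfi : ∀ b : (PadicAlgCl p)ˣ, (MulAction.stabilizer (Pi C) b).FiniteIndex)
  (O : Submonoid (PadicAlgCl p)ˣ)
  [MulDistribMulAction P₀ (PadicAlgCl p)ˣ]
  (c₀ : CyclotomeCoefficients φ₀ (D.lDeltaTheta l) (PadicAlgCl p)ˣ)
  (hA₀ : ∀ b : (PadicAlgCl p)ˣ, IsOpen (MulAction.stabilizer P₀ b : Set P₀))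
  (hfi₀ : ∀ b : (PadicAlgCl p)ˣ, (MulAction.stabilizer P₀ b).FiniteIndex)
  -- the module of FUNCTIONS with its Kummer data over `Π^tp_{Ÿ̲̲}`
  {Afun : Type} [CommGroup Afun] [MulDistribMulAction (Pi C) Afun] [TopologicalSpace Afun] [RootableBy Afun ℕ]
  (cf : CyclotomeCoefficients (phi C) (D.lDeltaTheta l) Afun)
  (hAf : ∀ a : Afun, IsOpen (MulAction.stabilizer (Pi C) a : Set (Pi C)))
  (hfif : ∀ a : Afun, (MulAction.stabilizer (Pi C) a).FiniteIndex)

/-- **(E1) over the action-level junction**: if `θ` is the Kummer class of a function `fΘ` (`hθf`), `ev_t : Afun →* ℚ̄_pˣ` are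
evaluations equivariant along the sections (`hev`) compatible with the coefficient data (`hcev`), and the VALUES are `ev_t fΘ = q_t`
(`hval`), then `R_t θ = κ₀ (q_t)` for `R_t` pinned to `h1LimComapAct … (s_t) … φ₀ (hφAct t)`. [cite: Mochizuki2012, Cor 2.8 (i) p.82] -/
theorem hRθ_toRecord_of_evaluation_act
    (R : Lbl → (((thetaEnvData C hC hS hl hp2 hpl hζ mods f hf hmods h15 L hZ hcharY hlim).toRecord
        (h1LimConjMulAut (phi C) (D.lDeltaTheta l) (PiYdd C))
        (h1LimKummerOn (phi C) (D.lDeltaTheta l) (PiYdd C) c hA hfi O) iota).H →*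
      Multiplicative (h1Lim φ₀ (D.lDeltaTheta l) (⊤ : Subgroup P₀) ⊥)))
    (hR : ∀ t y, Multiplicative.toAdd (R t y) =
      h1LimComapAct (phi C) (D.lDeltaTheta l) ((MonoidHom.id (Pi C)).comp (s t)) (hι t) φ₀ (hφAct t) (hN t)
        (AddEquiv.additiveMultiplicative (h1Lim (phi C) (D.lDeltaTheta l) (PiYdd C) ⊥) (Additive.ofMul y)))
    (ev : Lbl → (Afun →* (PadicAlgCl p)ˣ)) (hev : ∀ (t : Lbl) (g : P₀) (a : Afun), ev t (s t g • a) = g • ev t a)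
    (hcev : ∀ (t : Lbl) (ζ : cyclotome Afun), c₀.hom (cyclotome.map (ev t) ζ) = cf.hom ζ)
    {θ : ((thetaEnvData C hC hS hl hp2 hpl hζ mods f hf hmods h15 L hZ hcharY hlim).toRecord
        (h1LimConjMulAut (phi C) (D.lDeltaTheta l) (PiYdd C))
        (h1LimKummerOn (phi C) (D.lDeltaTheta l) (PiYdd C) c hA hfi O) iota).H}
    {fΘ : Afun}
    (hθf : AddEquiv.additiveMultiplicative (h1Lim (phi C) (D.lDeltaTheta l) (PiYdd C) ⊥) (Additive.ofMul θ) =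
      Multiplicative.toAdd (h1LimKummer (phi C) (D.lDeltaTheta l) (PiYdd C) cf hAf hfif fΘ))
    (q : Lbl → O) (hval : ∀ t, ev t fΘ = (q t : (PadicAlgCl p)ˣ)) (t : Lbl) :
    R t θ = h1LimKummerOn φ₀ (D.lDeltaTheta l) ⊤ c₀ hA₀ hfi₀ O (q t) := by
  apply Multiplicative.toAdd.injective
  rw [h1LimKummerOn_apply, ← hval t, hR, hθf]
  exact h1LimComapAct_h1LimKummer_map (phi C) (D.lDeltaTheta l) (PiYdd C) cf hAf hfif ((MonoidHom.id (Pi C)).comp (s t))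
    (hι t) φ₀ (hφAct t) (hN t) (ev t) (fun g a => hev t g a) c₀ (hcev t) hA₀ hfi₀ fΘ

/-- **IUTchII:Cor3.5(ii)** (kurims p.95) "`Ψ^ι_env(M^Θ_*) ⥲ Ψ_ξ(M^Θ_*)`" **at the genuine `θ_env` data over `ℚ̄_pˣ`, the labelled
copies identified through EQUALITY OF COEFFICIENT ACTIONS** (any inversion family `iota`): the UNIQUE restriction isomorphism
`Ψ^{i₀}_env(𝕄_*) ⥲ Ψ_ξ ⊆ ∏_t κ₀(O)`, `ξ = (κ₀ q_t)_t`, for restrictions `R_t` pinned to the action-level pull-backs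
`h1LimComapAct … (s_t) … φ₀ (hφAct t)`, with (K), (R), (E1), `hU`, `hUsurj`, `hinj`, `hq₀` DERIVED. Inputs: sections `s_t` with
`hφAct` (true for sections of `ε` over a common map, `hφAct_of_aug_eq`), `hact`, one finite-index `ε`-image; model data; `horb`;
the evaluation data (E2). [cite: Mochizuki2012, Cor 3.5 (ii) p.95] -/
theorem exists_unique_restrictionIso'_toRecord_padic_of_evaluation_act (hc : Function.Bijective c.hom)
    (hc₀ : Function.Bijective c₀.hom) (hc₀c : ∀ ζ, c₀.hom ζ = c.hom ζ)
    (hact : ∀ (t : Lbl) (g : P₀) (a : (PadicAlgCl p)ˣ), g • a = s t g • a) (t₁ : Lbl)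
    [((EtaleThetaDataOfSetting.aug C).comp (s t₁)).range.FiniteIndex]
    {i₀ : Iota}
    {θ : ((thetaEnvData C hC hS hl hp2 hpl hζ mods f hf hmods h15 L hZ hcharY hlim).toRecord
        (h1LimConjMulAut (phi C) (D.lDeltaTheta l) (PiYdd C))
        (h1LimKummerOn (phi C) (D.lDeltaTheta l) (PiYdd C) c hA hfi O) iota).H}
    (hθ : θ ∈ ((thetaEnvData C hC hS hl hp2 hpl hζ mods f hf hmods h15 L hZ hcharY hlim).toRecord
        (h1LimConjMulAut (phi C) (D.lDeltaTheta l) (PiYdd C))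
        (h1LimKummerOn (phi C) (D.lDeltaTheta l) (PiYdd C) c hA hfi O) iota).thetaEnv i₀)
    (horb : ∀ θ' ∈ ((thetaEnvData C hC hS hl hp2 hpl hζ mods f hf hmods h15 L hZ hcharY hlim).toRecord
        (h1LimConjMulAut (phi C) (D.lDeltaTheta l) (PiYdd C))
        (h1LimKummerOn (phi C) (D.lDeltaTheta l) (PiYdd C) c hA hfi O) iota).thetaEnv i₀,
      ∃ u ∈ ((thetaEnvData C hC hS hl hp2 hpl hζ mods f hf hmods h15 L hZ hcharY hlim).toRecord
        (h1LimConjMulAut (phi C) (D.lDeltaTheta l) (PiYdd C))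
        (h1LimKummerOn (phi C) (D.lDeltaTheta l) (PiYdd C) c hA hfi O) iota).units, θ' = u * θ)
    (R : Lbl → (((thetaEnvData C hC hS hl hp2 hpl hζ mods f hf hmods h15 L hZ hcharY hlim).toRecord
        (h1LimConjMulAut (phi C) (D.lDeltaTheta l) (PiYdd C))
        (h1LimKummerOn (phi C) (D.lDeltaTheta l) (PiYdd C) c hA hfi O) iota).H →*
      Multiplicative (h1Lim φ₀ (D.lDeltaTheta l) (⊤ : Subgroup P₀) ⊥)))
    (hR : ∀ t y, Multiplicative.toAdd (R t y) =
      h1LimComapAct (phi C) (D.lDeltaTheta l) ((MonoidHom.id (Pi C)).comp (s t)) (hι t) φ₀ (hφAct t) (hN t)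
        (AddEquiv.additiveMultiplicative (h1Lim (phi C) (D.lDeltaTheta l) (PiYdd C) ⊥) (Additive.ofMul y)))
    (ev : Lbl → (Afun →* (PadicAlgCl p)ˣ)) (hev : ∀ (t : Lbl) (g : P₀) (a : Afun), ev t (s t g • a) = g • ev t a)
    (hcev : ∀ (t : Lbl) (ζ : cyclotome Afun), c₀.hom (cyclotome.map (ev t) ζ) = cf.hom ζ)
    {fΘ : Afun}
    (hθf : AddEquiv.additiveMultiplicative (h1Lim (phi C) (D.lDeltaTheta l) (PiYdd C) ⊥) (Additive.ofMul θ) =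
      Multiplicative.toAdd (h1LimKummer (phi C) (D.lDeltaTheta l) (PiYdd C) cf hAf hfif fΘ))
    (q : Lbl → O) (hval : ∀ t, ev t fΘ = (q t : (PadicAlgCl p)ˣ)) (t₀ : Lbl) (hq : ¬ IsUnit (q t₀)) :
    ∃! e : ((thetaEnvData C hC hS hl hp2 hpl hζ mods f hf hmods h15 L hZ hcharY hlim).toRecord
          (h1LimConjMulAut (phi C) (D.lDeltaTheta l) (PiYdd C))
          (h1LimKummerOn (phi C) (D.lDeltaTheta l) (PiYdd C) c hA hfi O) iota).thetaMonoid i₀ ≃*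
        gaussianMonoid (fun t =>
          ((R t).comp (((thetaEnvData C hC hS hl hp2 hpl hζ mods f hf hmods h15 L hZ hcharY hlim).toRecord
              (h1LimConjMulAut (phi C) (D.lDeltaTheta l) (PiYdd C))
              (h1LimKummerOn (phi C) (D.lDeltaTheta l) (PiYdd C) c hA hfi O) iota).thetaMonoid i₀).subtype).codRestrict
            (MonoidHom.mrange (h1LimKummerOn φ₀ (D.lDeltaTheta l) ⊤ c₀ hA₀ hfi₀ O))
            (restriction_mem_mrange_gen
              ((thetaEnvData C hC hS hl hp2 hpl hζ mods f hf hmods h15 L hZ hcharY hlim).toRecord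
                (h1LimConjMulAut (phi C) (D.lDeltaTheta l) (PiYdd C))
                (h1LimKummerOn (phi C) (D.lDeltaTheta l) (PiYdd C) c hA hfi O) iota)
              (h1LimKummerOn (phi C) (D.lDeltaTheta l) (PiYdd C) c hA hfi O)
              (h1LimKummerOn φ₀ (D.lDeltaTheta l) ⊤ c₀ hA₀ hfi₀ O)
              (fun t => (R t).comp (((thetaEnvData C hC hS hl hp2 hpl hζ mods f hf hmods h15 L hZ hcharY hlim).toRecord
                (h1LimConjMulAut (phi C) (D.lDeltaTheta l) (PiYdd C))
                (h1LimKummerOn (phi C) (D.lDeltaTheta l) (PiYdd C) c hA hfi O) iota).thetaMonoid i₀).subtype)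
              q (hκ_padic C c hA hfi O hc) (ThetaEnvData.toRecord_constantMonoid _ _ _ _) hθ horb
              (fun t m hm => hRκ_toRecord_act C hC hS hl hp2 hpl hζ mods f hf hmods h15 L hZ hcharY hlim iota φ₀ s hι hN
                hφAct c hA hfi O c₀ hA₀ hfi₀ hc₀c hact R hR t m hm)
              (fun t => hRθ_toRecord_of_evaluation_act C hC hS hl hp2 hpl hζ mods f hf hmods h15 L hZ hcharY hlim iota φ₀ s hι
                hN hφAct c hA hfi O c₀ hA₀ hfi₀ cf hAf hfif R hR ev hev hcev hθf q hval t) t)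
            ⟨θ, thetaEnv_subset_thetaMonoid
              ((thetaEnvData C hC hS hl hp2 hpl hζ mods f hf hmods h15 L hZ hcharY hlim).toRecord
                (h1LimConjMulAut (phi C) (D.lDeltaTheta l) (PiYdd C))
                (h1LimKummerOn (phi C) (D.lDeltaTheta l) (PiYdd C) c hA hfi O) iota) i₀ hθ⟩),
      ∀ x, ((e x : gaussianMonoid _) : Lbl → MonoidHom.mrange (h1LimKummerOn φ₀ (D.lDeltaTheta l) ⊤ c₀ hA₀ hfi₀ O)) =
        MonoidHom.pi (fun t =>
          ((R t).comp (((thetaEnvData C hC hS hl hp2 hpl hζ mods f hf hmods h15 L hZ hcharY hlim).toRecord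
              (h1LimConjMulAut (phi C) (D.lDeltaTheta l) (PiYdd C))
              (h1LimKummerOn (phi C) (D.lDeltaTheta l) (PiYdd C) c hA hfi O) iota).thetaMonoid i₀).subtype).codRestrict
            (MonoidHom.mrange (h1LimKummerOn φ₀ (D.lDeltaTheta l) ⊤ c₀ hA₀ hfi₀ O))
            (restriction_mem_mrange_gen
              ((thetaEnvData C hC hS hl hp2 hpl hζ mods f hf hmods h15 L hZ hcharY hlim).toRecord
                (h1LimConjMulAut (phi C) (D.lDeltaTheta l) (PiYdd C))
                (h1LimKummerOn (phi C) (D.lDeltaTheta l) (PiYdd C) c hA hfi O) iota)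
              (h1LimKummerOn (phi C) (D.lDeltaTheta l) (PiYdd C) c hA hfi O)
              (h1LimKummerOn φ₀ (D.lDeltaTheta l) ⊤ c₀ hA₀ hfi₀ O)
              (fun t => (R t).comp (((thetaEnvData C hC hS hl hp2 hpl hζ mods f hf hmods h15 L hZ hcharY hlim).toRecord
                (h1LimConjMulAut (phi C) (D.lDeltaTheta l) (PiYdd C))
                (h1LimKummerOn (phi C) (D.lDeltaTheta l) (PiYdd C) c hA hfi O) iota).thetaMonoid i₀).subtype)
              q (hκ_padic C c hA hfi O hc) (ThetaEnvData.toRecord_constantMonoid _ _ _ _) hθ horb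
              (fun t m hm => hRκ_toRecord_act C hC hS hl hp2 hpl hζ mods f hf hmods h15 L hZ hcharY hlim iota φ₀ s hι hN
                hφAct c hA hfi O c₀ hA₀ hfi₀ hc₀c hact R hR t m hm)
              (fun t => hRθ_toRecord_of_evaluation_act C hC hS hl hp2 hpl hζ mods f hf hmods h15 L hZ hcharY hlim iota φ₀ s hι
                hN hφAct c hA hfi O c₀ hA₀ hfi₀ cf hAf hfif R hR ev hev hcev hθf q hval t) t)) x := by
  haveI : IsLeftCancelMul O := isLeftCancelMul_submonoid O
  exact exists_unique_restrictionIso'_ofKummer_gen_of_not_isUnit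
    ((thetaEnvData C hC hS hl hp2 hpl hζ mods f hf hmods h15 L hZ hcharY hlim).toRecord
      (h1LimConjMulAut (phi C) (D.lDeltaTheta l) (PiYdd C))
      (h1LimKummerOn (phi C) (D.lDeltaTheta l) (PiYdd C) c hA hfi O) iota)
    (h1LimKummerOn (phi C) (D.lDeltaTheta l) (PiYdd C) c hA hfi O)
    (h1LimKummerOn φ₀ (D.lDeltaTheta l) ⊤ c₀ hA₀ hfi₀ O)
    (fun t => (R t).comp (((thetaEnvData C hC hS hl hp2 hpl hζ mods f hf hmods h15 L hZ hcharY hlim).toRecord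
      (h1LimConjMulAut (phi C) (D.lDeltaTheta l) (PiYdd C))
      (h1LimKummerOn (phi C) (D.lDeltaTheta l) (PiYdd C) c hA hfi O) iota).thetaMonoid i₀).subtype)
    q (hκ_padic C c hA hfi O hc) (ThetaEnvData.toRecord_constantMonoid _ _ _ _) hθ horb
    (fun t m hm => hRκ_toRecord_act C hC hS hl hp2 hpl hζ mods f hf hmods h15 L hZ hcharY hlim iota φ₀ s hι hN hφAct c hA
      hfi O c₀ hA₀ hfi₀ hc₀c hact R hR t m hm)
    (fun t => hRθ_toRecord_of_evaluation_act C hC hS hl hp2 hpl hζ mods f hf hmods h15 L hZ hcharY hlim iota φ₀ s hι hN hφAct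
      c hA hfi O c₀ hA₀ hfi₀ cf hAf hfif R hR ev hev hcev hθf q hval t)
    (hκ₀_padic (C := C) (O := O) (φ₀ := φ₀) (s := s) (hι := hι) (c₀ := c₀) (hA₀ := hA₀) (hfi₀ := hfi₀) hc₀ t₁
      (hact t₁))
    t₀ hq

end Padic

end EtaleLevels

end Literature.IUT.HodgeArakelov

end
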